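import Mathlib
import Literature.Analysis.FluidPDE.Tao2016AveragedNS.BoundedEternalSolutions
import HarnessLib

/-!
# Static geometric cascades of a cancelling table are KOLMOGOROV (`g³ = Λ²`) and sub-surviving

Support lemma for the crux `WakeRatchet.TailRatchet` (stmt-NavierStokesRegularity-21808) and its repair
(evidence `evidence_21808_K41_universality.md` on the item): the WAKE deposited by a blow-up front of the
inviscid lattice of a table is, in the scale-ratio → 1 regime, a STATIC solution of the lattice; this file
records the one-line algebraic reason why every static geometric cascade is Kolmogorov.

In the rate variables `v_n = Λ^n X_n` (`Λ = bigLam ε₀ = (1+ε₀)^{5/2}`) the inviscid lattice of an S-table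
`(Q, A, B)` (`TaoCascade.STable`: energy-neutral intra-shell field, cancelling feed/back-reaction pair) reads
`v_n' = Q(v_n) + Λ A(v_{n-1}) + Λ⁻¹ B(v_{n+1}, v_n)`, autonomous and shell-independent.  A static geometric
family `v_n = gⁿ V` (with `Q`, `A` quadratic and `B` bilinear) solves it iff the single vector equation
`Q(V) + Λ g⁻² A(V) + Λ⁻¹ g B(V, V) = 0` holds; pairing it with `V` kills `Q` (`⟪V, Q V⟫ = 0`) and turns the
back-reaction into minus the flux (`⟪V, B(V,V)⟫ = −⟪V, A V⟫`), leaving `(Λ g⁻² − Λ⁻¹ g) ⟪V, A V⟫ = 0`: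
**a static cascade with non-zero energy flux has `g³ = Λ²`** (`staticCascade_cube_eq_sq`), i.e. physical
amplitudes `X_n = Λ^{-n/3} V` and per-shell energy ratio `μ = (g/Λ)² = Λ^{-2/3} = (1+ε₀)^{-5/3}`
(`staticCascade_ratio_cube`), strictly below the a=1 survival level `(1+ε₀)^{-1}`
(`staticCascade_ratio_lt_survival`) — the Cheskidov–Friedlander–Pavlović fixed point of the dyadic model,
for every cancelling table at once.  MODEL lattice algebra; nothing here concerns the Navier–Stokes equations.
-/

noncomputable section

set_option linter.dupNamespace false

namespace Summit.NavierStokesRegularity.NavierStokesRegularity.Theorems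

namespace WakeRatchetStaticCascade

open Literature.Analysis.FluidPDE Literature.Analysis.FluidPDE.TaoCascade
open scoped RealInnerProductSpace

variable {V : Type*} [NormedAddCommGroup V] [InnerProductSpace ℝ V]

/-- **Static geometric cascades are Kolmogorov.**  For an S-table `(Q, A, B)`, if `V` solves the static
geometric-cascade equation `Q V + (Λ/g²) A V + (g/Λ) B(V,V) = 0` with `Λ, g > 0` and carries a non-zero
energy flux `⟪V, A V⟫ ≠ 0`, then `g³ = Λ²`.
[cite: Tao2016AveragedNS, §4 (4.2)–(4.3) (cancellation), Lemma 4.1 (4.8); cell vocabulary (`STable`); the dyadic case is the fixed point of Cheskidov–Friedlander–Pavlović, arXiv:math/0610815] -/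
theorem staticCascade_cube_eq_sq {Q A : V → V} {B : V → V → V} {CA Λ g : ℝ} (hS : STable Q A B CA)
    (hΛ : 0 < Λ) (hg : 0 < g) {v : V}
    (hstat : Q v + (Λ / g ^ 2) • A v + (g / Λ) • B v v = 0) (hflux : ⟪v, A v⟫ ≠ 0) :
    g ^ 3 = Λ ^ 2 := by
  have h0 : ⟪v, Q v + (Λ / g ^ 2) • A v + (g / Λ) • B v v⟫ = 0 := by rw [hstat, inner_zero_right]
  rw [inner_add_right, inner_add_right, real_inner_smul_right, real_inner_smul_right, hS.intra v,
    zero_add] at h0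
  have hc : ⟪v, B v v⟫ = -⟪v, A v⟫ := by linarith [hS.cancel v v]
  rw [hc] at h0
  have h1 : (Λ / g ^ 2 - g / Λ) * ⟪v, A v⟫ = 0 := by linarith
  have h2 : Λ / g ^ 2 - g / Λ = 0 := by
    rcases mul_eq_zero.1 h1 with h | h
    · exact h
    · exact absurd h hflux
  have h3 : Λ / g ^ 2 = g / Λ := sub_eq_zero.1 h2
  rw [div_eq_div_iff (pow_pos hg 2).ne' hΛ.ne'] at h3
  nlinarith [h3]

/-- The per-shell ENERGY RATIO `μ = (g/Λ)²` of a static geometric cascade (`X_n = (g/Λ)ⁿ V` in physical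
amplitudes) satisfies `μ³ = Λ⁻²`; at `Λ = bigLam ε₀` this is `μ³ = (1+ε₀)^{-5}`, i.e. `μ = (1+ε₀)^{-5/3}`
(Kolmogorov scaling of the wake).
[cite: Tao2016AveragedNS, §4 (4.1), Lemma 4.1 (4.10); cell vocabulary] -/
theorem staticCascade_ratio_cube {ε₀ g : ℝ} (hε : 0 < ε₀) (hcube : g ^ 3 = bigLam ε₀ ^ 2) :
    ((g / bigLam ε₀) ^ 2) ^ 3 = ((1 + ε₀) ^ 5)⁻¹ := by
  have hb : 0 < bigLam ε₀ := bigLam_pos (by linarith)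
  rw [← bigLam_sq hε.le, div_pow, div_pow, ← pow_mul, ← pow_mul]
  have e1 : g ^ (2 * 3) = (g ^ 3) ^ 2 := by ring
  have e2 : bigLam ε₀ ^ (2 * 3) = (bigLam ε₀ ^ 2) ^ 3 := by ring
  rw [e1, e2, hcube]
  field_simp

/-- **Static cascades never survive NS-scaled dissipation**: the wake ratio `μ = (g/Λ)²` of a static
geometric cascade with non-zero flux is strictly below the a=1 survival level `(1+ε₀)⁻¹`
(`μ³ = (1+ε₀)^{-5} < (1+ε₀)^{-3}`).
[cite: Tao2016AveragedNS, §4, remark before Thm. 4.2 (dissipation `(1+ε₀)^{2n}` against the cascade); cell vocabulary] -/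
theorem staticCascade_ratio_lt_survival {Q A : V → V} {B : V → V → V} {CA ε₀ g : ℝ} (hS : STable Q A B CA)
    (hε : 0 < ε₀) (hg : 0 < g) {v : V}
    (hstat : Q v + (bigLam ε₀ / g ^ 2) • A v + (g / bigLam ε₀) • B v v = 0) (hflux : ⟪v, A v⟫ ≠ 0) :
    (g / bigLam ε₀) ^ 2 < (1 + ε₀)⁻¹ := by
  have hb : 0 < bigLam ε₀ := bigLam_pos (by linarith)
  have hcube := staticCascade_cube_eq_sq hS hb hg hstat hflux
  have h3 := staticCascade_ratio_cube hε hcube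
  -- compare cubes: μ³ = (1+ε₀)^{-5} < (1+ε₀)^{-3} = ((1+ε₀)⁻¹)³
  have hμ0 : 0 ≤ (g / bigLam ε₀) ^ 2 := sq_nonneg _
  have hq : 0 < 1 + ε₀ := by linarith
  by_contra hle
  push Not at hle
  have hmono : ((1 + ε₀)⁻¹) ^ 3 ≤ ((g / bigLam ε₀) ^ 2) ^ 3 :=
    pow_le_pow_left₀ (inv_nonneg.2 hq.le) hle 3
  rw [h3, inv_pow] at hmono
  -- (1+ε₀)^{-3} ≤ (1+ε₀)^{-5} is absurd for ε₀ > 0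
  have h5 : (1 + ε₀) ^ 3 < (1 + ε₀) ^ 5 := pow_lt_pow_right₀ (by linarith) (by norm_num)
  have h6 : ((1 + ε₀) ^ 5)⁻¹ < ((1 + ε₀) ^ 3)⁻¹ :=
    (inv_lt_inv₀ (pow_pos hq 5) (pow_pos hq 3)).2 h5
  linarith

end WakeRatchetStaticCascade

end Summit.NavierStokesRegularity.NavierStokesRegularity.Theorems

end
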